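import Summits.ResolutionOfSingularities.ResolutionOfSingularities.Theorems.HomologicalConductorNoZenoSplitGaloisPackage
import Summits.ResolutionOfSingularities.ResolutionOfSingularities.Theorems.HomologicalConductorNoZenoSplitChartGerm
import HarnessLib

/-!
# Crux `NoZenoR` (stmt-ResolutionOfSingularities-19943), β layer, slot 5 seam3 (RING half):
# the Galois splitting germ over the CHART germ `D' = (nrm B)_𝔮 → D'_f = (nrm B[β])_{𝔮_f}`

Route `ResolutionOfSingularities/HomologicalConductor`, crux chain W4.4.  OURS (cell res-hironaka; object (seam3-RING) of
planner res-L0-w44-plan-1 DESK WORD 23 2026-08-27T21:22:19Z, hand res-D-pv-039; consumer: res-L1-type-o5's (seam3-INST)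
`hasSplitExcCurveCountLE_chartGerm`, which feeds `…NoZenoMinimalityBaseChange.isMinimalResolution_pullback_snd_of_tower`
(p568188) exactly as res-L0-w44-stub-2's `…NoZenoMinimalityGerm` (p569791) does for the THREAD germ).  AI-written, weaker
than expert review; nothing here is a statement of the manuscript under review (Hironaka 2017); no Theses file is imported.
Def-free, fact-free, `--supports 19943 --as helper`.

The D2″ package `…SplitGaloisPackage.exists_galoisGerm₂` builds, over a local normal Noetherian `D ⊆ K` and a monic `f`
with `f_K` irreducible and `f̄` SEPARABLE IRREDUCIBLE, the tower `D → D_f → Ŝ` through the THREAD germ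
`D_f = locPrime (splitModel D f) (splitPrime D f) ≅ D[X]/(f)` (a LOCAL ring because `f̄` is irreducible).  Over the chart
germ `D' = (nrm B)_𝔮` the residue field grows and `f̄` may factor, so the upstairs chart germ
`D'_f = locPrime (adjoinBeta (nrm B) f_K) 𝔮_f` is only a LOCALISATION `(D'[X]/(f))_𝔓` of the one-root algebra at the
prime `𝔓 = fibrePrime` cut out by the chosen `𝔮_f` (res-D-pv-039 D2′ part 4b `…SplitFibreGerm`: `fibrePrime`,
`fibreGermEquiv`; part 4c/4d `…SplitChart`/`…SplitChartGerm`: `chartGerm_bundle`, `exists_chartGermData`).  This file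
re-runs the D2″ construction for such localised one-root germs:

* **`exists_algebra_tower_of_isLocalization`** — (B4′): for `D` a normal local domain with `Frac D = K`, `f` monic with
  `f_K` irreducible and `f̄` separable, `L/K` a splitting field of `f_K`, ANY prime `𝔓` of `D[X]/(f)` over `𝔪_D` and
  any local `D`-algebra `A ≃_D (D[X]/(f))_𝔓` which is formally unramified, essentially of finite type with
  `𝔪_D A = 𝔪_A`: there is a MAXIMAL ideal `𝔫` of `B := integralClosure D L` (chosen over `𝔓` along `root ↦ α`,
  lying-over) and an `A`-algebra structure on `Ŝ = B_𝔫` over `D` (`Localization.localRingHom`) which is LOCAL, FLAT,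
  UNRAMIFIED (`𝔪_A Ŝ = 𝔪_Ŝ`) with separable residue extension;
* **`exists_galoisGerm_of_isLocalization`** — the `exists_galoisGerm₂` binder list VERBATIM with the thread germ
  replaced by such an `A` (`Ŝ` Noetherian normal local domain, flat local unramified over `D`, `κ(Ŝ)/κ(D)` finite
  GALOIS, `dim Ŝ = dim D`, finite étale layer `D → B → Ŝ = B_𝔫`, finite group `H` with `ρ : H →* (Ŝ ≃ₐ[D] Ŝ)`
  inducing every `κ(D)`-automorphism of `κ(Ŝ)`, and the tower `D → A → Ŝ`);
* **`exists_galoisGerm_chart`** — the instantiation at `exists_chartGermData`'s chart germ: `D' = locPrimeSubalgebra R 𝔮`,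
  `A = D'_f = locPrime (adjoinBeta R f_K) 𝔮_f` with the `D'`-algebra structure `fibreGermAlgebra` (= the map `φ` of
  `exists_chartGermData`), `f ↦ chartPoly = f.map (D ⊆ D')`, `𝔓 = fibrePrime`, `e = fibreGermEquiv`.

References: J. Lipman, Publ. Math. IHÉS 36 (1969), §16 (16.1), (16.5), pp. 231–235 (context: base change of
desingularizations to étale-local extensions) [`Lipman1969`]; N. Bourbaki, *Algèbre commutative* V §2 (decomposition
group and residue automorphisms) [folklore]; The Stacks Project, Tags 00UE, 04GM [`StacksProject`].
-/

noncomputable section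

-- single-problem summit: the doubled namespace component `ResolutionOfSingularities` is forced
set_option linter.dupNamespace false

open Polynomial IsLocalRing

namespace Summit.ResolutionOfSingularities.ResolutionOfSingularities.Theorems.NoZeno.SplittingBase

universe u

/-! ## §1 (B4′): the tower over a LOCALISED one-root germ -/

section TowerLoc

variable {D K L : Type u} [CommRing D] [IsDomain D] [IsIntegrallyClosed D] [IsLocalRing D]
  [Field K] [Algebra D K] [IsFractionRing D K] [Field L] [Algebra K L] [Algebra D L]
  [IsScalarTower D K L]

omit [IsDomain D] [IsIntegrallyClosed D] [IsLocalRing D] [IsFractionRing D K] in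
/-- `f_K` irreducible (monic `f`) has a root in the splitting field `L`, integral over `D`. [folklore] -/
theorem exists_root_integralClosure {f : D[X]} (hf : f.Monic) [Fact (Irreducible (f.map (algebraMap D K)))]
    [Polynomial.IsSplittingField K L (f.map (algebraMap D K))] :
    ∃ a : integralClosure D L, aeval a f = 0 := by
  have hsplit := splits_map_of_isSplittingField (K := K) (L := L) f
  have hdeg : (f.map (algebraMap D L)).degree ≠ 0 := by
    rw [hf.degree_map, ← hf.degree_map (algebraMap D K)]
    exact (degree_pos_of_irreducible (Fact.out : Irreducible (f.map (algebraMap D K)))).ne'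
  obtain ⟨x, hx⟩ := hsplit.exists_eval_eq_zero hdeg
  have hxroot : x ∈ f.rootSet L := by
    rw [mem_rootSet']
    exact ⟨(hf.map _).ne_zero, by rwa [aeval_def, ← eval_map]⟩
  refine ⟨⟨x, rootSet_subset_integralClosure hf hxroot⟩, ?_⟩
  apply Subtype.val_injective
  rw [← Subalgebra.aeval_coe, Subalgebra.coe_zero]
  exact (mem_rootSet'.mp hxroot).2

omit [IsDomain D] [IsIntegrallyClosed D] [IsLocalRing D] in
/-- `D[X]/(f) → integralClosure D L`, `root ↦ α`, is INJECTIVE when `f` is monic and `f_K` irreducible (`f_K` is then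
the minimal polynomial of `α`, and `f_K ∣ p_K ⇒ f ∣ p` for monic `f`). [folklore] -/
theorem lift_integralClosure_injective {f : D[X]} (hf : f.Monic) [Fact (Irreducible (f.map (algebraMap D K)))]
    (a : integralClosure D L) (ha : f.eval₂ (algebraMap D (integralClosure D L)) a = 0) :
    Function.Injective (AdjoinRoot.lift (algebraMap D (integralClosure D L)) a ha) := by
  rw [injective_iff_map_eq_zero]
  intro z hz
  obtain ⟨p, rfl⟩ := AdjoinRoot.mk_surjective z
  rw [AdjoinRoot.lift_mk] at hz
  rw [AdjoinRoot.mk_eq_zero]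
  -- `p(α) = 0` and `f(α) = 0` in `L`
  have h1 : aeval (a : L) p = 0 := by
    have h := congrArg ((integralClosure D L).val.toRingHom) hz
    rw [map_zero, Polynomial.hom_eval₂ p (algebraMap D (integralClosure D L))
      (integralClosure D L).val.toRingHom a] at h
    rw [aeval_def, IsScalarTower.algebraMap_eq D (integralClosure D L) L]
    exact h
  have hfa : aeval (a : L) (f.map (algebraMap D K)) = 0 := by
    have h := congrArg ((integralClosure D L).val.toRingHom) ha
    rw [map_zero, Polynomial.hom_eval₂ f (algebraMap D (integralClosure D L))
      (integralClosure D L).val.toRingHom a] at h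
    rw [aeval_map_algebraMap, aeval_def, IsScalarTower.algebraMap_eq D (integralClosure D L) L]
    exact h
  have hmin : f.map (algebraMap D K) = minpoly K (a : L) :=
    minpoly.eq_of_irreducible_of_monic Fact.out hfa (hf.map _)
  have hdvdK : f.map (algebraMap D K) ∣ p.map (algebraMap D K) := by
    rw [hmin]
    exact minpoly.dvd K (a : L) (by rwa [aeval_map_algebraMap])
  exact (Polynomial.map_dvd_map (algebraMap D K) (IsFractionRing.injective D K) hf).mp hdvdK

/-- **(B4′) `Ŝ` over a LOCALISED one-root germ.**  `D` a normal local domain with `Frac D = K`; `f ∈ D[X]` monic with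
`f_K` irreducible and separable reduction `f̄`; `L/K` a splitting field of `f_K`; `𝔓` a prime of `D[X]/(f)` over `𝔪_D`;
`A` a local `D`-algebra, formally unramified and essentially of finite type with `𝔪_D A = 𝔪_A`, isomorphic over `D`
to `(D[X]/(f))_𝔓`.  Then for SOME maximal ideal `𝔫` of `B = integralClosure D L` (one over `𝔓` along `root ↦ α`),
`Ŝ := B_𝔫` is a FLAT, LOCAL, UNRAMIFIED `A`-algebra over `D` with separable residue extension.  ((B4) of
`…SplitGaloisTower` is the case `𝔓` = the unique prime, `f̄` irreducible.) [folklore; this work for the packaging] -/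
theorem exists_algebra_tower_of_isLocalization {f : D[X]} (hf : f.Monic)
    (hsep : (f.map (IsLocalRing.residue D)).Separable) [Fact (Irreducible (f.map (algebraMap D K)))]
    [Polynomial.IsSplittingField K L (f.map (algebraMap D K))]
    (𝔓 : Ideal (AdjoinRoot f)) [𝔓.IsPrime] (h𝔓 : 𝔓.comap (algebraMap D (AdjoinRoot f)) = maximalIdeal D)
    {A : Type u} [CommRing A] [IsLocalRing A] [Algebra D A] [Algebra.FormallyUnramified D A]
    [Algebra.EssFiniteType D A] (e : Localization.AtPrime 𝔓 ≃ₐ[D] A)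
    (hmA : (maximalIdeal D).map (algebraMap D A) = maximalIdeal A) :
    ∃ (𝔫 : Ideal (integralClosure D L)) (_ : 𝔫.IsMaximal)
      (_ : Algebra A (Localization.AtPrime 𝔫)) (_ : IsScalarTower D A (Localization.AtPrime 𝔫))
      (_ : IsLocalHom (algebraMap A (Localization.AtPrime 𝔫)))
      (_ : Module.Flat A (Localization.AtPrime 𝔫)),
      (maximalIdeal A).map (algebraMap A (Localization.AtPrime 𝔫)) =
          maximalIdeal (Localization.AtPrime 𝔫) ∧
        Algebra.IsSeparable (ResidueField A) (ResidueField (Localization.AtPrime 𝔫)) := by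
  classical
  -- a root `α` of `f` in `B = integralClosure D L` and the injection `φ : D[X]/(f) → B`, `root ↦ α`
  obtain ⟨a, ha1⟩ := exists_root_integralClosure (K := K) (L := L) hf
  have ha : f.eval₂ (algebraMap D (integralClosure D L)) a = 0 := by rw [← aeval_def]; exact ha1
  let φ : AdjoinRoot f →+* integralClosure D L := AdjoinRoot.lift (algebraMap D (integralClosure D L)) a ha
  have hφof : ∀ d : D, φ (AdjoinRoot.of f d) = algebraMap D (integralClosure D L) d :=
    fun d => RingHom.congr_fun (AdjoinRoot.lift_comp_of ha) d
  have hφinj : Function.Injective φ := lift_integralClosure_injective (K := K) (L := L) hf a ha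
  -- a prime `𝔫` of `B` over `𝔓` (lying over along the integral injection `φ`)
  letI algφ : Algebra (AdjoinRoot f) (integralClosure D L) := φ.toAlgebra
  haveI : IsScalarTower D (AdjoinRoot f) (integralClosure D L) :=
    IsScalarTower.of_algebraMap_eq fun d => by
      rw [RingHom.algebraMap_toAlgebra, AdjoinRoot.algebraMap_eq, hφof]
  haveI : Algebra.IsIntegral (AdjoinRoot f) (integralClosure D L) := Algebra.IsIntegral.tower_top (R := D)
  obtain ⟨𝔫, -, h𝔫p, h𝔫c⟩ := Ideal.exists_ideal_over_prime_of_isIntegral 𝔓 (⊥ : Ideal (integralClosure D L))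
    (by
      change RingHom.ker φ ≤ 𝔓
      rw [(RingHom.injective_iff_ker_eq_bot φ).mp hφinj]
      exact bot_le)
  haveI := h𝔫p
  have h𝔫D : 𝔫.comap (algebraMap D (integralClosure D L)) = maximalIdeal D := by
    rw [IsScalarTower.algebraMap_eq D (AdjoinRoot f) (integralClosure D L), ← Ideal.comap_comap, h𝔫c, h𝔓]
  haveI h𝔫max : 𝔫.IsMaximal :=
    Ideal.isMaximal_of_isIntegral_of_isMaximal_comap (R := D) 𝔫 (h𝔫D ▸ maximalIdeal.isMaximal D)
  -- the map `A ≃ (D[X]/(f))_𝔓 → B_𝔫 = Ŝ`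
  have hIJ : 𝔓 = 𝔫.comap φ := h𝔫c.symm
  let ψ : A →+* Localization.AtPrime 𝔫 :=
    (Localization.localRingHom 𝔓 𝔫 φ hIJ).comp e.symm.toRingEquiv.toRingHom
  letI : Algebra A (Localization.AtPrime 𝔫) := ψ.toAlgebra
  have htower : IsScalarTower D A (Localization.AtPrime 𝔫) := by
    refine IsScalarTower.of_algebraMap_eq fun d => ?_
    rw [RingHom.algebraMap_toAlgebra, RingHom.comp_apply]
    have h1 : e.symm.toRingEquiv.toRingHom (algebraMap D A d) = algebraMap D (Localization.AtPrime 𝔓) d := by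
      change e.symm (algebraMap D A d) = _
      rw [AlgEquiv.commutes]
    rw [h1, IsScalarTower.algebraMap_apply D (AdjoinRoot f) (Localization.AtPrime 𝔓),
      Localization.localRingHom_to_map, IsScalarTower.algebraMap_apply D (integralClosure D L)
        (Localization.AtPrime 𝔫), AdjoinRoot.algebraMap_eq, hφof]
  -- the bundle over `A`
  haveI := flat_localization_integralClosure (K := K) hf hsep 𝔫
  have hflatf : Module.Flat A (Localization.AtPrime 𝔫) :=
    Algebra.FormallyUnramified.flat_of_restrictScalars (R := D) (S := A) (Localization.AtPrime 𝔫)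
  have hm := map_maximalIdeal_localization_integralClosure (K := K) hf hsep 𝔫
  have hmf : (maximalIdeal A).map (algebraMap A (Localization.AtPrime 𝔫)) =
      maximalIdeal (Localization.AtPrime 𝔫) := by
    rw [← hmA, Ideal.map_map, ← IsScalarTower.algebraMap_eq]
    exact hm
  haveI hlocf : IsLocalHom (algebraMap A (Localization.AtPrime 𝔫)) :=
    ((IsLocalRing.local_hom_TFAE (algebraMap A (Localization.AtPrime 𝔫))).out 0 2).mpr hmf.le
  haveI := formallyUnramified_localization_integralClosure (K := K) hf hsep 𝔫
  haveI := essFiniteType_localization_integralClosure (K := K) hf hsep 𝔫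
  haveI : Algebra.FormallyUnramified A (Localization.AtPrime 𝔫) :=
    Algebra.FormallyUnramified.of_restrictScalars D _ _
  haveI : Algebra.EssFiniteType A (Localization.AtPrime 𝔫) := Algebra.EssFiniteType.of_comp D _ _
  have hsepf : Algebra.IsSeparable (ResidueField A) (ResidueField (Localization.AtPrime 𝔫)) :=
    inferInstance
  exact ⟨𝔫, h𝔫max, inferInstance, htower, hlocf, hflatf, hmf, hsepf⟩

end TowerLoc

/-! ## §2 The D2″ package over a localised one-root germ -/

section Package

open Summit.ResolutionOfSingularities.ResolutionOfSingularities.Theorems.NoZeno.SandwichCluster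

set_option maxHeartbeats 400000 in
/-- **D2″ package over a LOCALISED one-root germ** (`exists_galoisGerm₂` with the thread germ replaced by any
`A ≃_D (D[X]/(f))_𝔓`).  For `D` a local Noetherian normal domain with fraction field `K`, `f ∈ D[X]` monic with `f_K`
irreducible and `f̄` separable, a prime `𝔓` of `D[X]/(f)` over `𝔪_D`, and a local `D`-algebra `A`, formally
unramified, essentially of finite type, `𝔪_D A = 𝔪_A`, with `e : (D[X]/(f))_𝔓 ≃ₐ[D] A`: there are a local Noetherian
normal domain `Ŝ`, flat, local and unramified over `D`, `κ(Ŝ)/κ(D)` finite GALOIS, `dim Ŝ = dim D`; the finite étale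
layer `D → B → Ŝ = B_𝔫`; an `A`-algebra structure over `D` on `Ŝ`, flat, local, unramified with separable residue
extension; and a finite group `H`, `ρ : H →* (Ŝ ≃ₐ[D] Ŝ)`, inducing every `κ(D)`-automorphism of `κ(Ŝ)`.
[folklore; this work for the packaging] -/
theorem exists_galoisGerm_of_isLocalization {D K : Type} [CommRing D] [IsDomain D] [IsIntegrallyClosed D]
    [IsLocalRing D] [IsNoetherianRing D] [Field K] [Algebra D K] [IsFractionRing D K]
    (f : D[X]) [Fact (Irreducible (f.map (algebraMap D K)))] (hf : f.Monic)
    (hsep : (f.map (residue D)).Separable)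
    (𝔓 : Ideal (AdjoinRoot f)) [𝔓.IsPrime] (h𝔓 : 𝔓.comap (algebraMap D (AdjoinRoot f)) = maximalIdeal D)
    (A : Type) [CommRing A] [IsLocalRing A] [Algebra D A] [Algebra.FormallyUnramified D A]
    [Algebra.EssFiniteType D A] (e : Localization.AtPrime 𝔓 ≃ₐ[D] A)
    (hmA : (maximalIdeal D).map (algebraMap D A) = maximalIdeal A) :
    ∃ (Ŝ : Type) (_ : CommRing Ŝ) (_ : IsLocalRing Ŝ) (_ : IsNoetherianRing Ŝ) (_ : IsDomain Ŝ)
      (_ : IsIntegrallyClosed Ŝ) (_ : Algebra D Ŝ)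
      (B : Type) (_ : CommRing B) (_ : Algebra D B) (_ : Algebra B Ŝ) (_ : IsScalarTower D B Ŝ)
      (𝔫 : Ideal B) (_ : 𝔫.IsPrime) (_ : IsLocalization.AtPrime Ŝ 𝔫)
      (_ : Algebra A Ŝ) (_ : IsScalarTower D A Ŝ)
      (_ : IsLocalHom (algebraMap D Ŝ)) (_ : IsLocalHom (algebraMap A Ŝ))
      (_ : Module.Flat D Ŝ) (_ : Module.Flat A Ŝ)
      (H : Type) (_ : Group H) (_ : Finite H) (ρ : H →* (Ŝ ≃ₐ[D] Ŝ)),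
      Algebra.FormallyUnramified D B ∧ Algebra.FiniteType D B ∧
      (maximalIdeal D).map (algebraMap D Ŝ) = maximalIdeal Ŝ ∧
      (maximalIdeal A).map (algebraMap A Ŝ) = maximalIdeal Ŝ ∧
      FiniteDimensional (ResidueField D) (ResidueField Ŝ) ∧
      IsGalois (ResidueField D) (ResidueField Ŝ) ∧
      Algebra.IsSeparable (ResidueField A) (ResidueField Ŝ) ∧
      ringKrullDim Ŝ = ringKrullDim D ∧
      (∀ σ : ResidueField Ŝ ≃ₐ[ResidueField D] ResidueField Ŝ, ∃ h : H, ∀ x : Ŝ,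
        residue Ŝ (ρ h x) = σ (residue Ŝ x)) := by
  classical
  -- the splitting field and the integral closure
  let L : Type := (f.map (algebraMap D K)).SplittingField
  haveI : Polynomial.IsSplittingField K L (f.map (algebraMap D K)) :=
    Polynomial.IsSplittingField.splittingField _
  haveI : FiniteDimensional K L :=
    Polynomial.IsSplittingField.finiteDimensional L (f.map (algebraMap D K))
  -- the finite étale layer `B = integralClosure D L`
  haveI hB : Algebra.Etale D (integralClosure D L) :=
    etale_integralClosure hf (splits_map_of_isSplittingField (K := K) f) hsep
      (adjoin_rootSet_eq_top_of_isSplittingField (K := K) f)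
  haveI hBfin : Module.Finite D (integralClosure D L) :=
    finite_integralClosure hf (splits_map_of_isSplittingField (K := K) f) hsep
      (adjoin_rootSet_eq_top_of_isSplittingField (K := K) f)
  have hBunr : Algebra.FormallyUnramified D (integralClosure D L) := inferInstance
  have hBft : Algebra.FiniteType D (integralClosure D L) := inferInstance
  -- the tower over `A`, choosing `𝔫`
  obtain ⟨𝔫, h𝔫, instA, htower, hlocf, hflatf, hmf, hsepf⟩ :=
    exists_algebra_tower_of_isLocalization (K := K) (L := L) hf hsep 𝔓 h𝔓 e hmA
  have hBtower := isScalarTower_localization_integralClosure (D := D) (L := L) 𝔫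
  have hBloc : IsLocalization.AtPrime (Localization.AtPrime 𝔫) 𝔫 := inferInstance
  -- the germ and its bundle over `D`
  haveI hloc := isLocalHom_algebraMap_localization_integralClosure (D := D) (L := L) 𝔫
  have hflat := flat_localization_integralClosure (K := K) hf hsep 𝔫
  have hm := map_maximalIdeal_localization_integralClosure (K := K) hf hsep 𝔫
  have hfin := finite_residueField_localization_integralClosure (K := K) hf hsep 𝔫
  have hsepR := isSeparable_residueField_localization_integralClosure (K := K) hf hsep 𝔫
  have hnorm := normal_residueField_localization_integralClosure (K := K) hf hsep 𝔫
  have hnoeth := isNoetherianRing_localization_integralClosure (K := K) hf hsep 𝔫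
  have hdim := ringKrullDim_localization_integralClosure (K := K) hf hsep 𝔫
  have hic := isIntegrallyClosed_localization_integralClosure (D := D) (K := K) (L := L) 𝔫
  have hdom : IsDomain (Localization.AtPrime 𝔫) :=
    IsLocalization.isDomain_localization
      (le_nonZeroDivisors_of_noZeroDivisors fun h => h (Ideal.zero_mem 𝔫))
  -- the symmetry
  obtain ⟨H, hH, hHf, ρ, hρ⟩ := exists_group_hom_residue_surjective (K := K) (L := L) hf hsep 𝔫
  exact ⟨Localization.AtPrime 𝔫, inferInstance, inferInstance, hnoeth, hdom, hic, inferInstance,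
    integralClosure D L, inferInstance, inferInstance, inferInstance, hBtower, 𝔫, inferInstance,
    hBloc, instA, htower, hloc, hlocf, hflat, hflatf, H, hH, hHf, ρ, hBunr, hBft, hm, hmf,
    hfin, isGalois_iff.mpr ⟨hsepR, hnorm⟩, hsepf, hdim, hρ⟩

end Package

/-! ## §3 The instantiation at the chart germ of `exists_chartGermData` -/

section Chart

open Summit.ResolutionOfSingularities.ResolutionOfSingularities.Theorems.NoZeno.SandwichCluster
open Parasite (locPrime isLocalRing_locPrime)

variable {k K : Type} [Field k] [Field K] [Algebra k K]

set_option maxHeartbeats 400000 in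
/-- **(seam3-RING) The Galois splitting germ over the CHART germ.**  In the setting of `exists_chartGermData`
(`D ≤ R ⊆ K`, `D` local, `R` Noetherian normal with `Frac R = K`, `f ∈ D[X]` monic with `f_K` irreducible and `f̄`
separable, `𝔮` a prime of `R`) and for its outputs `𝔮_f` (a prime of `adjoinBeta R f_K` over `𝔮`, `hover`): writing
`D' := locPrimeSubalgebra R 𝔮` and `D'_f := locPrime (adjoinBeta R f_K) 𝔮_f` with the `D'`-algebra structure
`fibreGermAlgebra` (whose `algebraMap` is `exists_chartGermData`'s `φ`), the `exists_galoisGerm₂` binder list holds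
VERBATIM with `(D, D_f) ↦ (D', D'_f)`: a local Noetherian normal domain `Ŝ`, flat, local and unramified over `D'`,
`κ(Ŝ)/κ(D')` finite GALOIS with symmetry `ρ : H →* (Ŝ ≃ₐ[D'] Ŝ)`, `dim Ŝ = dim D'`, the finite étale layer
`D' → B → Ŝ = B_𝔫`, and the tower `D' → D'_f → Ŝ` flat, local, unramified with separable residue extension —
exactly the ring inputs of `…NoZenoMinimalityBaseChange.isMinimalResolution_pullback_snd_of_tower`.
[folklore; this work for the packaging] -/
theorem exists_galoisGerm_chart (D R : Subalgebra k K) (hDR : D ≤ R) (f : (↥D)[X])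
    [Fact (Irreducible (f.map (algebraMap ↥D K)))] (𝔮 : Ideal ↥R) (h𝔮 : 𝔮.IsPrime)
    [IsLocalRing ↥D] [IsNoetherianRing ↥R] [IsIntegrallyClosed ↥R] [IsFractionRing ↥R K]
    (hf : f.Monic) (hsep : (f.map (residue ↥D)).Separable)
    (𝔮f : Ideal ↥(adjoinBeta R (f.map (algebraMap ↥D K)))) (h𝔮f : 𝔮f.IsPrime)
    (hover : ∀ r : ↥R, toAdjoinBeta R (f.map (algebraMap ↥D K)) r ∈ 𝔮f ↔ r ∈ 𝔮) :
    letI := fibreGermAlgebra _ _ _ (chartPoly_map D R hDR f 𝔮 h𝔮) _ (chartGerm_le D R hDR f 𝔮 h𝔮 𝔮f h𝔮f hover)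
    ∃ (Ŝ : Type) (_ : CommRing Ŝ) (_ : IsLocalRing Ŝ) (_ : IsNoetherianRing Ŝ) (_ : IsDomain Ŝ)
      (_ : IsIntegrallyClosed Ŝ) (_ : Algebra ↥(locPrimeSubalgebra R 𝔮 h𝔮) Ŝ)
      (B : Type) (_ : CommRing B) (_ : Algebra ↥(locPrimeSubalgebra R 𝔮 h𝔮) B) (_ : Algebra B Ŝ)
      (_ : IsScalarTower ↥(locPrimeSubalgebra R 𝔮 h𝔮) B Ŝ)
      (𝔫 : Ideal B) (_ : 𝔫.IsPrime) (_ : IsLocalization.AtPrime Ŝ 𝔫)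
      (_ : Algebra ↥(locPrime (adjoinBeta R (f.map (algebraMap ↥D K))) 𝔮f h𝔮f) Ŝ)
      (_ : IsScalarTower ↥(locPrimeSubalgebra R 𝔮 h𝔮)
        ↥(locPrime (adjoinBeta R (f.map (algebraMap ↥D K))) 𝔮f h𝔮f) Ŝ)
      (_ : IsLocalHom (algebraMap ↥(locPrimeSubalgebra R 𝔮 h𝔮) Ŝ))
      (_ : IsLocalHom (algebraMap ↥(locPrime (adjoinBeta R (f.map (algebraMap ↥D K))) 𝔮f h𝔮f) Ŝ))
      (_ : Module.Flat ↥(locPrimeSubalgebra R 𝔮 h𝔮) Ŝ)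
      (_ : Module.Flat ↥(locPrime (adjoinBeta R (f.map (algebraMap ↥D K))) 𝔮f h𝔮f) Ŝ)
      (H : Type) (_ : Group H) (_ : Finite H) (ρ : H →* (Ŝ ≃ₐ[↥(locPrimeSubalgebra R 𝔮 h𝔮)] Ŝ)),
      Algebra.FormallyUnramified ↥(locPrimeSubalgebra R 𝔮 h𝔮) B ∧
      Algebra.FiniteType ↥(locPrimeSubalgebra R 𝔮 h𝔮) B ∧
      (maximalIdeal ↥(locPrimeSubalgebra R 𝔮 h𝔮)).map (algebraMap _ Ŝ) = maximalIdeal Ŝ ∧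
      (maximalIdeal ↥(locPrime (adjoinBeta R (f.map (algebraMap ↥D K))) 𝔮f h𝔮f)).map
          (algebraMap _ Ŝ) = maximalIdeal Ŝ ∧
      FiniteDimensional (ResidueField ↥(locPrimeSubalgebra R 𝔮 h𝔮)) (ResidueField Ŝ) ∧
      IsGalois (ResidueField ↥(locPrimeSubalgebra R 𝔮 h𝔮)) (ResidueField Ŝ) ∧
      Algebra.IsSeparable (ResidueField ↥(locPrime (adjoinBeta R (f.map (algebraMap ↥D K))) 𝔮f h𝔮f))
        (ResidueField Ŝ) ∧
      ringKrullDim Ŝ = ringKrullDim ↥(locPrimeSubalgebra R 𝔮 h𝔮) ∧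
      (∀ σ : ResidueField Ŝ ≃ₐ[ResidueField ↥(locPrimeSubalgebra R 𝔮 h𝔮)] ResidueField Ŝ, ∃ h : H,
        ∀ x : Ŝ, residue Ŝ (ρ h x) = σ (residue Ŝ x)) := by
  letI instAlg := fibreGermAlgebra _ _ _ (chartPoly_map D R hDR f 𝔮 h𝔮) _
    (chartGerm_le D R hDR f 𝔮 h𝔮 𝔮f h𝔮f hover)
  -- the chart polynomial `f' = f.map (D ⊆ D')`, monic, `f'_K = f_K` irreducible, `f̄'` separable
  set f' := chartPoly D R hDR f 𝔮 h𝔮 with hf'def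
  have hf' : f'.Monic := hf.map _
  haveI : Fact (Irreducible (f'.map (algebraMap ↥(locPrimeSubalgebra R 𝔮 h𝔮) K))) :=
    ⟨by rw [hf'def, chartPoly_map]; exact Fact.out⟩
  have hu : IsUnit (AdjoinRoot.mk f (derivative f)) := isUnit_mk_derivative_of_separable_map hf hsep
  have hu' : IsUnit (AdjoinRoot.mk f' (derivative f')) := isUnit_mk_derivative_map
    (Subalgebra.inclusion (hDR.trans (le_locPrimeSubalgebra R 𝔮 h𝔮))).toRingHom hu
  have hsep' : (f'.map (residue _)).Separable := by
    rw [← ResidueField.algebraMap_eq]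
    exact separable_map_of_isUnit_mk_derivative hu'
  -- the local-étale bundle of the chart germ `D' → D'_f`
  obtain ⟨hlh, hN, hfl, hur, heft, hm, -, -, -, -⟩ := chartGerm_bundle D R hDR f 𝔮 h𝔮 𝔮f h𝔮f hover hf hu
  haveI := hur
  haveI := heft
  -- `D'_f ≃ (D'[X]/(f'))_𝔓`, `𝔓 = fibrePrime` over `𝔪_{D'}`
  let e := fibreGermEquiv _ _ _ (chartPoly_map D R hDR f 𝔮 h𝔮) _
    (chartGerm_le D R hDR f 𝔮 h𝔮 𝔮f h𝔮f hover) (chartGerm_frac D R hDR f 𝔮 h𝔮 𝔮f h𝔮f hover) hf'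
  have h𝔓 := comap_fibrePrime_eq _ _ _ (chartPoly_map D R hDR f 𝔮 h𝔮) _
    (chartGerm_le D R hDR f 𝔮 h𝔮 𝔮f h𝔮f hover) (chartGerm_local D R hDR f 𝔮 h𝔮 𝔮f h𝔮f hover)
  exact exists_galoisGerm_of_isLocalization (K := K) f' hf' hsep' _ h𝔓 _ e hm

end Chart

end Summit.ResolutionOfSingularities.ResolutionOfSingularities.Theorems.NoZeno.SplittingBase

end
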